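import Mathlib
import Literature.Analysis.FluidPDE.VectorCalculus

/-!
# Change of units for the filament skeleton (stub `stub_unitsAssembly`, line `Sketch`)

Bookkeeping stub of line `Sketch` for the crux `FilamentSkeletonRss.SkeletonEquilibrium`
(stmt-NavierStokesRegularity-15400). The line constructs the vortex-filament relative equilibria
in RESCALED units `X_j = Ξ_j(√Γ ·)/√Γ`, where the only trace of the circulation `Γ` is the
regularisation core `e = 1/√Γ`. This file is the pure change of units back: with `s = √Γ`
(so `Γ = s²`, `e = 1/s`), `Ξ_j(τ) := s • X_j(τ/s)` and `w_j(τ) := s · V_j(τ/s)`,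

* the curve clauses transfer (`C²`, injective, unit speed, curvature `‖Ξ″‖ · s = ‖X″‖ ≤ K`,
  properness at both ends), the slip stays differentiable with `w_j′(τ) = V_j′(τ/s)`;
* the separation `ρ` becomes `ρ s`;
* the regularised Biot–Savart integrand with core `1` at `x` is `s⁻²` times the `X`-units
  integrand with core `1/s` at `s⁻¹ x`, evaluated at `σ/s` (so integrability transfers by the
  substitution `σ = s u`, `MeasureTheory.Integrable.comp_div`), and its integral is `s⁻¹` times
  the `X`-units integral (`MeasureTheory.Measure.integral_comp_div`);
* hence the equilibrium identity with circulation factor `4` and core `1/s` becomes the crux's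
  identity with factor `Γ · 16π/(4π) = 4 s²` and core `1`: both sides get multiplied by `s`
  (the rotating Leray drift `½ y + (5/8) e₃ × y` is linear).

Everything is elementary (chain rule, `‖s v‖ = s ‖v‖`, `(s²)^{3/2} = s³`, linear substitution in
a Bochner integral over `ℝ`).
-/

namespace Summit.NavierStokesRegularity.NavierStokesRegularity.Theorems.SkeletonEquilibrium.Sketch
set_option linter.dupNamespace false

noncomputable section

open Set MeasureTheory Filter Topology
open Literature.Analysis.FluidPDE

/-- `v × (c • d) = c • (v × d)`. [folklore] -/
private theorem cross_smul_right (v d : EuclideanSpace ℝ (Fin 3)) (c : ℝ) :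
    cross v (c • d) = c • cross v d := by
  rw [← crossCLM_apply, map_smul, crossCLM_apply]

/-- Chain rule for the change of units: `(s X(·/s))′(τ) = X′(τ/s)` (`s ≠ 0`). [folklore] -/
private theorem deriv_rescale_curve {s : ℝ} (hs : s ≠ 0) (X : ℝ → EuclideanSpace ℝ (Fin 3))
    (τ : ℝ) : deriv (fun τ => s • X (τ / s)) τ = deriv X (τ / s) := by
  have h1 : (fun τ => s • X (τ / s)) = fun τ => s • X (s⁻¹ * τ) := by
    funext τ; rw [div_eq_inv_mul]
  rw [h1, deriv_fun_const_smul_field, deriv_comp_mul_left s⁻¹ X τ, smul_smul, mul_inv_cancel₀ hs,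
    one_smul, inv_mul_eq_div]

/-- Chain rule for the slip: `(s V(·/s))′(τ) = V′(τ/s)` (`s ≠ 0`). [folklore] -/
private theorem deriv_rescale_slip {s : ℝ} (hs : s ≠ 0) (V : ℝ → ℝ) (τ : ℝ) :
    deriv (fun τ => s * V (τ / s)) τ = deriv V (τ / s) := by
  have h1 : (fun τ => s * V (τ / s)) = fun τ => s * V (s⁻¹ * τ) := by
    funext τ; rw [div_eq_inv_mul]
  rw [h1, deriv_const_mul_field, deriv_comp_mul_left s⁻¹ V τ, smul_eq_mul, ← mul_assoc,
    mul_inv_cancel₀ hs, one_mul, inv_mul_eq_div]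

/-- Second derivative under the change of units: `(s X(·/s))″(τ) = s⁻¹ X″(τ/s)`. [folklore] -/
private theorem iteratedDeriv_two_rescale_curve {s : ℝ} (hs : s ≠ 0)
    (X : ℝ → EuclideanSpace ℝ (Fin 3)) (τ : ℝ) :
    iteratedDeriv 2 (fun τ => s • X (τ / s)) τ = s⁻¹ • iteratedDeriv 2 X (τ / s) := by
  have h1 : deriv (fun τ => s • X (τ / s)) = fun τ => deriv X (s⁻¹ * τ) := by
    funext σ; rw [deriv_rescale_curve hs, div_eq_inv_mul]
  rw [iteratedDeriv_succ, iteratedDeriv_one, h1, deriv_comp_mul_left s⁻¹ (deriv X) τ,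
    iteratedDeriv_succ, iteratedDeriv_one, inv_mul_eq_div]

/-- `C²` regularity is preserved by the change of units. [folklore] -/
private theorem contDiff_rescale_curve (s : ℝ) {X : ℝ → EuclideanSpace ℝ (Fin 3)}
    (hX : ContDiff ℝ 2 X) : ContDiff ℝ 2 (fun τ => s • X (τ / s)) :=
  (hX.comp (contDiff_id.div_const s)).const_smul s

/-- Differentiability of the rescaled slip. [folklore] -/
private theorem differentiable_rescale_slip (s : ℝ) {V : ℝ → ℝ} (hV : Differentiable ℝ V) :
    Differentiable ℝ (fun τ => s * V (τ / s)) :=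
  (hV.comp (differentiable_id.div_const s)).const_mul s

/-- Injectivity is preserved by the change of units (`s ≠ 0`). [folklore] -/
private theorem injective_rescale_curve {s : ℝ} (hs : s ≠ 0) {X : ℝ → EuclideanSpace ℝ (Fin 3)}
    (hX : Function.Injective X) : Function.Injective (fun τ => s • X (τ / s)) := by
  intro a b hab
  have h := hX (smul_right_injective _ hs hab)
  field_simp at h
  exact h

/-- Properness at `+∞` is preserved by the change of units (`0 < s`). [folklore] -/
private theorem tendsto_rescale_curve_atTop {s : ℝ} (hs : 0 < s)
    {X : ℝ → EuclideanSpace ℝ (Fin 3)} (hX : Tendsto (fun t => ‖X t‖) atTop atTop) :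
    Tendsto (fun τ => ‖s • X (τ / s)‖) atTop atTop := by
  have h := (hX.comp (tendsto_id.atTop_div_const hs)).const_mul_atTop hs
  refine h.congr fun τ => ?_
  simp [norm_smul, abs_of_pos hs]

/-- Properness at `−∞` is preserved by the change of units (`0 < s`). [folklore] -/
private theorem tendsto_rescale_curve_atBot {s : ℝ} (hs : 0 < s)
    {X : ℝ → EuclideanSpace ℝ (Fin 3)} (hX : Tendsto (fun t => ‖X t‖) atBot atTop) :
    Tendsto (fun τ => ‖s • X (τ / s)‖) atBot atTop := by
  have h := (hX.comp (tendsto_id.atBot_div_const hs)).const_mul_atTop hs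
  refine h.congr fun τ => ?_
  simp [norm_smul, abs_of_pos hs]

/-- `(s²)^{3/2} = s³` for `0 ≤ s`. [folklore] -/
private theorem sq_rpow_three_halves {s : ℝ} (hs : 0 ≤ s) : (s ^ 2) ^ (3 / 2 : ℝ) = s ^ 3 := by
  rw [← Real.rpow_natCast s 2, ← Real.rpow_mul hs, ← Real.rpow_natCast s 3]
  norm_num

/-- Scaling of the Rosenhead kernel: `((‖s v‖² + 1)^{3/2})⁻¹ = s⁻³ ((‖v‖² + s⁻²)^{3/2})⁻¹`
(`0 < s`). [folklore] -/
private theorem kernel_rescale {s : ℝ} (hs : 0 < s) (v : EuclideanSpace ℝ (Fin 3)) :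
    ((‖s • v‖ ^ 2 + 1) ^ (3 / 2 : ℝ))⁻¹
      = (s ^ 3)⁻¹ * ((‖v‖ ^ 2 + (1 / s) ^ 2) ^ (3 / 2 : ℝ))⁻¹ := by
  have hA : 0 ≤ ‖v‖ ^ 2 + (1 / s) ^ 2 := by positivity
  have h1 : ‖s • v‖ ^ 2 + 1 = s ^ 2 * (‖v‖ ^ 2 + (1 / s) ^ 2) := by
    rw [norm_smul, Real.norm_eq_abs, abs_of_pos hs]
    field_simp
  rw [h1, Real.mul_rpow (sq_nonneg s) hA, sq_rpow_three_halves hs.le, mul_inv]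

/-- The rescaled Biot–Savart integrand at `x = s y` is `s⁻²` times the `X`-units integrand at
`y`, evaluated at `σ/s`. [folklore] -/
private theorem integrand_rescale {s : ℝ} (hs : 0 < s) (X : ℝ → EuclideanSpace ℝ (Fin 3))
    (y : EuclideanSpace ℝ (Fin 3)) (σ : ℝ) :
    ((‖s • y - s • X (σ / s)‖ ^ 2 + 1) ^ (3 / 2 : ℝ))⁻¹ •
        cross (deriv (fun τ => s • X (τ / s)) σ) (s • y - s • X (σ / s))
      = (s ^ 2)⁻¹ • (((‖y - X (σ / s)‖ ^ 2 + (1 / s) ^ 2) ^ (3 / 2 : ℝ))⁻¹ •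
          cross (deriv X (σ / s)) (y - X (σ / s))) := by
  rw [← smul_sub, kernel_rescale hs, deriv_rescale_curve hs.ne', cross_smul_right, smul_smul,
    smul_smul]
  congr 1
  field_simp

/-- Integrability of the rescaled Biot–Savart integrand at every point `x` (write `x = s y`,
`y = s⁻¹ x`, and substitute `σ = s u`). [folklore] -/
private theorem integrable_rescale {s : ℝ} (hs : 0 < s) (X : ℝ → EuclideanSpace ℝ (Fin 3))
    (hX : ∀ y : EuclideanSpace ℝ (Fin 3), Integrable (fun u : ℝ =>
      ((‖y - X u‖ ^ 2 + (1 / s) ^ 2) ^ (3 / 2 : ℝ))⁻¹ • cross (deriv X u) (y - X u)))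
    (x : EuclideanSpace ℝ (Fin 3)) :
    Integrable (fun σ : ℝ => ((‖x - s • X (σ / s)‖ ^ 2 + 1) ^ (3 / 2 : ℝ))⁻¹ •
      cross (deriv (fun τ => s • X (τ / s)) σ) (x - s • X (σ / s))) := by
  have hx : x = s • (s⁻¹ • x) := (smul_inv_smul₀ hs.ne' x).symm
  have h := ((hX (s⁻¹ • x)).comp_div hs.ne').smul ((s ^ 2)⁻¹ : ℝ)
  refine h.congr (Eventually.of_forall fun σ => ?_)
  have := integrand_rescale hs X (s⁻¹ • x) σ
  rw [← hx] at this
  simpa using this.symm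

/-- The rescaled Biot–Savart integral at `s y` is `s⁻¹` times the `X`-units integral at `y`
(substitution `σ = s u`: `∫ f(σ/s) dσ = s ∫ f(u) du`). [folklore] -/
private theorem integral_rescale {s : ℝ} (hs : 0 < s) (X : ℝ → EuclideanSpace ℝ (Fin 3))
    (y : EuclideanSpace ℝ (Fin 3)) :
    ∫ σ : ℝ, ((‖s • y - s • X (σ / s)‖ ^ 2 + 1) ^ (3 / 2 : ℝ))⁻¹ •
        cross (deriv (fun τ => s • X (τ / s)) σ) (s • y - s • X (σ / s))
      = s⁻¹ • ∫ u : ℝ, ((‖y - X u‖ ^ 2 + (1 / s) ^ 2) ^ (3 / 2 : ℝ))⁻¹ •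
          cross (deriv X u) (y - X u) := by
  simp_rw [integrand_rescale hs X y]
  rw [integral_smul,
    Measure.integral_comp_div (fun u => ((‖y - X u‖ ^ 2 + (1 / s) ^ 2) ^ (3 / 2 : ℝ))⁻¹ •
      cross (deriv X u) (y - X u)) s,
    smul_smul, abs_of_pos hs]
  congr 1
  field_simp

/-- One interaction term of the equilibrium identity in `Ξ`-units (circulation factor
`s² · 16π/(4π) = 4 s²`, core `1`) is `s` times the `X`-units term (factor `4`, core `1/s`).
[folklore] -/
private theorem summand_rescale {s : ℝ} (hs : 0 < s) (X : ℝ → EuclideanSpace ℝ (Fin 3))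
    (y : EuclideanSpace ℝ (Fin 3)) :
    (s ^ 2 * (16 * Real.pi) / (4 * Real.pi)) • ∫ σ : ℝ,
        ((‖s • y - s • X (σ / s)‖ ^ 2 + 1) ^ (3 / 2 : ℝ))⁻¹ •
          cross (deriv (fun τ => s • X (τ / s)) σ) (s • y - s • X (σ / s))
      = s • ((4 : ℝ) • ∫ u : ℝ, ((‖y - X u‖ ^ 2 + (1 / s) ^ 2) ^ (3 / 2 : ℝ))⁻¹ •
          cross (deriv X u) (y - X u)) := by
  rw [integral_rescale hs X y, smul_smul, smul_smul]
  congr 1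
  field_simp [Real.pi_ne_zero]
  ring

/-- **Bookkeeping stub (`stub_unitsAssembly`).** The change of units `Ξ_j(τ) = s X_j(τ/s)`,
`w_j(τ) = s V_j(τ/s)` (`Γ = s²`, core `e = 1/s`, `0 < s`): the curve clauses (`C²`, injective,
unit speed, `‖X″‖ ≤ K`, proper at both ends), the differentiability of the slips, the pairwise
separation `ρ`, the kernel integrability and the equilibrium identity in `X`-units (circulation
factor `4`, core `1/s`) give the crux's clauses in `Ξ`-units (curvature `‖Ξ″‖ · s ≤ K`,
separation `ρ s`, core `1`, circulation factor `s² · 16π/(4π) = 4 s²`), and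
`w_j′(τ) = V_j′(τ/s)`. (Chain rule; `‖s v‖ = s‖v‖`; substitution `σ = s u` in the Bochner
integrals, `∫ f(σ/s) dσ = s ∫ f(u) du`; linearity of the drift `½ y + (5/8) e₃ × y`.) [folklore] -/
theorem stub_unitsAssembly :
    ∀ (s K ρ : ℝ) (X : Fin 4 → ℝ → EuclideanSpace ℝ (Fin 3)) (V : Fin 4 → ℝ → ℝ), 0 < s →
      (∀ j, ContDiff ℝ 2 (X j) ∧ Function.Injective (X j) ∧ Differentiable ℝ (V j) ∧
          (∀ t, ‖deriv (X j) t‖ = 1) ∧ (∀ t, ‖iteratedDeriv 2 (X j) t‖ ≤ K) ∧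
          Tendsto (fun t => ‖X j t‖) atTop atTop ∧ Tendsto (fun t => ‖X j t‖) atBot atTop) →
      (∀ j k, j ≠ k → ∀ t u, ρ ≤ ‖X j t - X k u‖) →
      (∀ j (y : EuclideanSpace ℝ (Fin 3)), Integrable (fun u : ℝ =>
          ((‖y - X j u‖ ^ 2 + (1 / s) ^ 2) ^ (3 / 2 : ℝ))⁻¹ • cross (deriv (X j) u) (y - X j u))) →
      (∀ j t, (∑ k : Fin 4, (4 : ℝ) • ∫ u : ℝ,
            ((‖X j t - X k u‖ ^ 2 + (1 / s) ^ 2) ^ (3 / 2 : ℝ))⁻¹ • cross (deriv (X k) u) (X j t - X k u))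
          + (1 / 2 : ℝ) • X j t - (-5 / 8 : ℝ) • cross (EuclideanSpace.single (2 : Fin 3) (1 : ℝ)) (X j t)
          = V j t • deriv (X j) t) →
      (∀ j, ContDiff ℝ 2 (fun τ => s • X j (τ / s)) ∧ Function.Injective (fun τ => s • X j (τ / s)) ∧
          Differentiable ℝ (fun τ => s * V j (τ / s)) ∧
          (∀ τ, ‖deriv (fun τ => s • X j (τ / s)) τ‖ = 1) ∧
          (∀ τ, ‖iteratedDeriv 2 (fun τ => s • X j (τ / s)) τ‖ * s ≤ K) ∧
          Tendsto (fun τ => ‖s • X j (τ / s)‖) atTop atTop ∧ Tendsto (fun τ => ‖s • X j (τ / s)‖) atBot atTop) ∧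
      (∀ j k, j ≠ k → ∀ τ σ, ρ * s ≤ ‖s • X j (τ / s) - s • X k (σ / s)‖) ∧
      (∀ j (x : EuclideanSpace ℝ (Fin 3)), Integrable (fun σ : ℝ =>
          ((‖x - s • X j (σ / s)‖ ^ 2 + 1) ^ (3 / 2 : ℝ))⁻¹ •
            cross (deriv (fun τ => s • X j (τ / s)) σ) (x - s • X j (σ / s)))) ∧
      (∀ j τ, (∑ k : Fin 4, (s ^ 2 * (16 * Real.pi) / (4 * Real.pi)) • ∫ σ : ℝ,
            ((‖s • X j (τ / s) - s • X k (σ / s)‖ ^ 2 + 1) ^ (3 / 2 : ℝ))⁻¹ •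
              cross (deriv (fun τ => s • X k (τ / s)) σ) (s • X j (τ / s) - s • X k (σ / s)))
          + (1 / 2 : ℝ) • (s • X j (τ / s))
          - (-5 / 8 : ℝ) • cross (EuclideanSpace.single (2 : Fin 3) (1 : ℝ)) (s • X j (τ / s))
          = (s * V j (τ / s)) • deriv (fun τ => s • X j (τ / s)) τ) ∧
      (∀ j τ, deriv (fun τ => s * V j (τ / s)) τ = deriv (V j) (τ / s)) := by
  intro s K ρ X V hs ha hb hc hd
  have hsne : s ≠ 0 := hs.ne'
  refine ⟨fun j => ?_, fun j k hjk τ σ => ?_, fun j x => integrable_rescale hs (X j) (hc j) x,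
    fun j τ => ?_, fun j τ => deriv_rescale_slip hsne (V j) τ⟩
  · -- (a) curve clauses and the slip
    obtain ⟨h1, h2, h3, h4, h5, h6, h7⟩ := ha j
    refine ⟨contDiff_rescale_curve s h1, injective_rescale_curve hsne h2,
      differentiable_rescale_slip s h3, fun τ => ?_, fun τ => ?_,
      tendsto_rescale_curve_atTop hs h6, tendsto_rescale_curve_atBot hs h7⟩
    · rw [deriv_rescale_curve hsne (X j) τ]
      exact h4 _
    · rw [iteratedDeriv_two_rescale_curve hsne (X j) τ, norm_smul, norm_inv, Real.norm_eq_abs,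
        abs_of_pos hs]
      have hcancel : s⁻¹ * ‖iteratedDeriv 2 (X j) (τ / s)‖ * s = ‖iteratedDeriv 2 (X j) (τ / s)‖ := by
        field_simp
      rw [hcancel]
      exact h5 _
  · -- (b) separation
    rw [← smul_sub, norm_smul, Real.norm_eq_abs, abs_of_pos hs, mul_comm]
    exact mul_le_mul_of_nonneg_left (hb j k hjk _ _) hs.le
  · -- (d) the equilibrium identity: `s •` the `X`-units identity at `t = τ/s`
    rw [Finset.sum_congr rfl fun k _ => summand_rescale hs (X k) (X j (τ / s)), ← Finset.smul_sum,
      deriv_rescale_curve hsne (X j) τ, cross_smul_right, mul_smul, ← hd j (τ / s)]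
    module

end

end Summit.NavierStokesRegularity.NavierStokesRegularity.Theorems.SkeletonEquilibrium.Sketch
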